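import Literature.AnabelianGeometry.EtaleTheta.ThetaSubquotientOfThetaSetting
import HarnessLib

/-!
# [EtTh] §5 — the theta subquotients `(l·Δ_Θ)_{(-)}` of a `ThetaSetting` READ ON A QUOTIENT BASE `B^temp(G′)⁰` along `φ : Π^tp_X̲̲ ↠ G′` (§5 p.327 (PDF p.101))

S. Mochizuki, *The étale theta function …*, Publ. RIMS **45** (2009) [MochizukiEtTh2009], §5 p.327 (PDF p.101): «the subquotients
`Π^tp_X ↠ (Π^tp_X)^Θ ⊇ l·Δ_Θ` determine subquotients `Aut_D(D) ↠ Aut^Θ_D(D) ⊇ (l·Δ_Θ)_D`» — for `D` an object of the base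
category, on which `Π^tp_X` acts THROUGH the structure morphism of the base.  [cite: MochizukiEtTh2009, §5 p.327 (PDF p.101)]
PAGE CONVENTION for [EtTh]: «printed N (PDF p.M)», N = M + 226.

abc-iut cell, layer L2 = [EtTh], seat abc-iut-L2-t4 (gen 10; §5 junction lineage), the D3 «q_C-LIFT» RIDER of
plan/L2/SUBDAG-EtTh-JUNCTION.md (abc-iut-L2-lead R1297 / R1331 (β) / R1339; census D3 of abc-iut-L2-t3 gen 10: «transporting the pin
itself to `B^temp(Compat₃′)⁰` would need `Ker φ ≤ Ker toTheta|` (one more displayed clause) — the honest gap between "Q of the model"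
and "Q of the Setting read on the model"»).  ADDITIVE; consumed BY NAME: abc-iut-L2-t9's R2 instance `ThetaSubquotient.thetaSubquotientStub
q ι` (p428064) and its PIN `ThetaSubquotient.ofSettingSub D l U := thetaSubquotientStub (qSub D U) (ιTheta D l)` (abc-iut-L2-t4 gen 5 /
abc-iut-L2-t9, `ThetaSubquotientOfThetaSetting`); Mathlib's `MonoidHom.liftOfSurjective`.
* §1 GENERIC: for a surjection `φ : G ↠ G′` with `Ker φ ≤ Ker q`, **`qLift φ hφ q hker : G′ →* Q`**, the unique factorisation
  `qLift ∘ φ = q` (`qLift_comp`, `qLift_apply`, `qLift_unique`), and **`liftStub φ hφ q ι hker := thetaSubquotientStub (qLift …) ι`**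
  over `B^temp(G′)⁰` — the SAME subquotient datum `(Q, ι)` read on the coverings of `G′` (on which `G` acts through `φ`); its
  carrier / transport `rfl` lemmas.
* §2 AT THE PIN: **`ofSettingSubLift D l U φ hφ hker : ThetaSubquotientStub (ConnectedPart (BTemp G′))`** — the theta subquotients
  of the `ThetaSetting` `D` (`q := toTheta|_U`, `ι := l·Δ_Θ ↪ (Π^tp_X)^Θ`) over `B^temp(G′)⁰` for ANY surjection `φ : U ↠ G′`
  killing `Ker(toTheta|_U)`; DISPLAYED CLAUSE `hker : φ.ker ≤ (qSub D U).ker` (census (J3b)); `ofSettingSubLift_eq`,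
  `qLift_qSub_comp`; at `G′ := Compat₃′` this is the «Q of the Setting read on the model's base», living next to the model's own
  `Θ̈`-coordinate stub `ThetaCoord.thetaStub l` (p504128) in the same type `ThetaSubquotientStub.{0} (ConnectedPart (BTemp Compat₃′))`
  — either may be fed to the §5 datum constructor (`Discharge/Sec5FirstDatumThetaTwistTower`, FILE 2).
HONEST FRAMING: a construction over abc-iut-L2-t1's DATA structure `ThetaSetting`; `φ` and `hker` are DISPLAYED hypotheses (the
genuine `φ = ((κ_ϖ, κ_Ü, κ_Θ̈), χ, γ)` is not in the tree; whether its kernel lies in `Ker toTheta|` is NOT claimed); no comparison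
isomorphism `(l·Δ_Θ)^{lift}_E ≅ (l·Δ_Θ)_{φ^*E}` is asserted here (it is the next rider if a consumer asks).  [EtTh] is a refereed
prerequisite paper; nothing here bears on, or takes a side on, the disputed [IUTchIII] Cor. 3.12; nothing here asserts abc proved or
refuted; typed ≠ proved.
-/

noncomputable section

namespace Literature.AnabelianGeometry.EtaleTheta

open CategoryTheory Literature.AlgebraicGeometry.Frobenioids Literature.AnabelianGeometry.SemiGraphs

-- `l·Δ_Θ` is a `CommGroup` through Mathlib's scoped `IsMulCommutative` instance (the device of `ThetaSubquotientOfThetaSetting`).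
open scoped IsMulCommutative

namespace ThetaSubquotient

/-! ## §1 Reading a subquotient datum `(q, ι)` on a quotient base -/

section Lift

universe u u' v w

variable {G : Type u} [Group G] {G' : Type u'} [Group G'] {Q : Type v} [Group Q] {Λ : Type w} [CommGroup Λ]
  (φ : G →* G') (hφ : Function.Surjective φ) (q : G →* Q) (ι : Λ →* Q) (hker : φ.ker ≤ q.ker)

/-- **`q` read on `G′`**: the unique homomorphism `q̄ : G′ → Q` with `q̄ ∘ φ = q`, for a surjection `φ : G ↠ G′` killing `Ker q`
(Mathlib's `MonoidHom.liftOfSurjective`). [cite: MochizukiEtTh2009, §5 p.327 (PDF p.101)] -/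
def qLift : G' →* Q := φ.liftOfSurjective hφ ⟨q, hker⟩

/-- `q̄ ∘ φ = q`. [cite: MochizukiEtTh2009, §5 p.327 (PDF p.101)] -/
theorem qLift_comp : (qLift φ hφ q hker).comp φ = q :=
  φ.liftOfRightInverse_comp _ _ ⟨q, hker⟩

/-- `q̄ (φ g) = q g`. [cite: MochizukiEtTh2009, §5 p.327 (PDF p.101)] -/
theorem qLift_apply (g : G) : qLift φ hφ q hker (φ g) = q g :=
  φ.liftOfRightInverse_comp_apply _ _ ⟨q, hker⟩ g

/-- Uniqueness: any `h : G′ → Q` with `h ∘ φ = q` IS `q̄`. [cite: MochizukiEtTh2009, §5 p.327 (PDF p.101)] -/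
theorem qLift_unique (h : G' →* Q) (hh : h.comp φ = q) : h = qLift φ hφ q hker :=
  φ.eq_liftOfRightInverse _ _ q hker h hh

/-- The image of `q̄` is the image of `q`. [cite: MochizukiEtTh2009, §5 p.327 (PDF p.101)] -/
theorem range_qLift : (qLift φ hφ q hker).range = q.range := by
  ext x
  constructor
  · rintro ⟨g', rfl⟩
    obtain ⟨g, rfl⟩ := hφ g'
    exact ⟨g, (qLift_apply φ hφ q hker g).symm⟩
  · rintro ⟨g, rfl⟩
    exact ⟨φ g, qLift_apply φ hφ q hker g⟩

variable [TopologicalSpace G'] [ι.range.Normal]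

/-- **The subquotient datum `(q, ι)` READ ON `B^temp(G′)⁰`** — abc-iut-L2-t9's R2 instance at `(q̄, ι)`: for a connected covering
`E` of `G′` (on which `G` acts through `φ`), `(l·Δ_Θ)_E :=` compatible families `E → Λ/ι⁻¹J(Stab x)`.
[cite: MochizukiEtTh2009, §5 p.327 (PDF p.101)] -/
def liftStub : FrobenioidTheta.ThetaSubquotientStub.{max u' w} (ConnectedPart (BTemp G')) :=
  thetaSubquotientStub (qLift φ hφ q hker) ι

/-- `liftStub` IS the R2 instance at `(q̄, ι)` (definitionally) — its laws (`ThetaSubquotientOfTemperedGalois/Aut/Quotient`,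
`Discharge/Sec5TransportLaws`, …) apply verbatim. [cite: MochizukiEtTh2009, §5 p.327 (PDF p.101)] -/
theorem liftStub_eq : liftStub φ hφ q ι hker = thetaSubquotientStub (qLift φ hφ q hker) ι := rfl

/-- The carrier at `E`: `(l·Δ_Θ)_E = LDelta q̄ ι E`. [cite: MochizukiEtTh2009, §5 p.327 (PDF p.101)] -/
theorem liftStub_lDelta (E : ConnectedPart (BTemp G')) : (liftStub φ hφ q ι hker).lDelta E = LDelta (qLift φ hφ q hker) ι E.obj :=
  rfl

/-- The transport along `f : E → E′` is the push-forward `map`. [cite: MochizukiEtTh2009, §5 p.327 (PDF p.101)] -/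
theorem liftStub_lDeltaMap {E E' : ConnectedPart (BTemp G')} (f : E ⟶ E') :
    (liftStub φ hφ q ι hker).lDeltaMap f = map (qLift φ hφ q hker) ι E.property E'.property f.hom := rfl

end Lift

/-! ## §2 At the pin: the theta subquotients of a `ThetaSetting` over `B^temp(G′)⁰` -/

section PinLift

universe u'

variable {p : ℕ} [Fact p.Prime] (D : ThetaSetting p) (l : ℕ) (U : Subgroup D.PiTemp)
  {G' : Type u'} [Group G'] [TopologicalSpace G'] (φ : ↥U →* G') (hφ : Function.Surjective φ)
  (hker : φ.ker ≤ (qSub D U).ker)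

/-- **The theta subquotients `(l·Δ_Θ)_{(-)}` of the `ThetaSetting` `D` over `B^temp(G′)⁰`** along a surjection `φ : U ↠ G′`
(`U ⊆ Π^tp_X`, e.g. `Π^tp_X̲̲`) with the DISPLAYED clause `Ker φ ≤ Ker(toTheta|_U)`: `q := toTheta|_U` read on `G′`,
`ι := l·Δ_Θ ↪ (Π^tp_X)^Θ` — the PIN `ofSettingSub D l U` transported to the quotient base (junction rider D3, «Q of the Setting read
on the model's base»; at `G′ := Compat₃′` it has the type of the model's own `ThetaCoord.thetaStub l`).
[cite: MochizukiEtTh2009, §5 p.327 (PDF p.101)] -/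
def ofSettingSubLift : FrobenioidTheta.ThetaSubquotientStub.{u'} (ConnectedPart (BTemp G')) :=
  liftStub φ hφ (qSub D U) (ιTheta D l) hker

/-- `ofSettingSubLift` IS the R2 instance at `(toTheta|_U read on G′, ι)` (definitionally). [cite: MochizukiEtTh2009, §5 p.327 (PDF p.101)] -/
theorem ofSettingSubLift_eq :
    ofSettingSubLift D l U φ hφ hker = thetaSubquotientStub (qLift φ hφ (qSub D U) hker) (ιTheta D l) := rfl

omit [TopologicalSpace G'] in
/-- The read-off `q̄` composes back to the pin's `q = toTheta|_U`. [cite: MochizukiEtTh2009, §5 p.327 (PDF p.101)] -/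
theorem qLift_qSub_comp : (qLift φ hφ (qSub D U) hker).comp φ = qSub D U := qLift_comp φ hφ _ hker

omit [TopologicalSpace G'] in
/-- … and has the same image `toTheta(U) ⊆ (Π^tp_X)^Θ`. [cite: MochizukiEtTh2009, §5 p.327 (PDF p.101)] -/
theorem range_qLift_qSub : (qLift φ hφ (qSub D U) hker).range = (qSub D U).range := range_qLift φ hφ _ hker

/-- The carrier at a connected covering `E` of `G′`. [cite: MochizukiEtTh2009, §5 p.327 (PDF p.101)] -/
theorem ofSettingSubLift_lDelta (E : ConnectedPart (BTemp G')) :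
    (ofSettingSubLift D l U φ hφ hker).lDelta E = LDelta (qLift φ hφ (qSub D U) hker) (ιTheta D l) E.obj := rfl

omit [TopologicalSpace G'] in
/-- At `φ := id` (no quotient) the lift is the pin itself: `q̄ = q`. [cite: MochizukiEtTh2009, §5 p.327 (PDF p.101)] -/
theorem qLift_id : qLift (MonoidHom.id ↥U) Function.surjective_id (qSub D U) (by simp [MonoidHom.ker_id]) = qSub D U :=
  (qLift_unique _ _ _ _ (qSub D U) (MonoidHom.comp_id _)).symm

end PinLift

end ThetaSubquotient

end Literature.AnabelianGeometry.EtaleTheta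

end
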